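import Mathlib

/-!
# Sketch — crux idea `graded-thin-side` (val-idea-31 g2, round 2) for
`GrenetZeon.DualUnipotentThreeHalves` (stmt-ValiantsHypothesis-24318).

First lemmas of the line, stated over Mathlib only.  `sorry` = signature only
(ideation discipline: no proofs here).  VP ≠ VNP is NOT proved.
-/

namespace Summit.ValiantsHypothesis.ValiantsHypothesis.Cruxes.DualUnipotentThreeHalves.GradedThinSide

open Matrix

/-- ORDER-(2,2) NECKLACE PAIRING.  In a linear space of nilpotent matrices the
balanced words of length four pair the two generators:
`tr((AB)²) = -2·tr(A²B²)` (the `s²t²`-coefficient of `tr((sA+tB)⁴) = 0`: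
four rotations of `AABB` and two of `ABAB`).  First checkable statement of the line. -/
theorem trace_mulSq_pairing {d : ℕ} (A B : Matrix (Fin d) (Fin d) ℂ)
    (h : ∀ s t : ℂ, IsNilpotent (s • A + t • B)) :
    Matrix.trace ((A * B) ^ 2) = -2 * Matrix.trace (A ^ 2 * B ^ 2) := by
  -- `tr((A+B)⁴) + tr((A−B)⁴) = 2·tr(A⁴) + 2·tr(B⁴) + 8·tr(A²B²) + 4·tr((AB)²)`, all four fourth-power traces vanish.
  have tr4 : ∀ X : Matrix (Fin d) (Fin d) ℂ, IsNilpotent X → Matrix.trace (X ^ 4) = 0 :=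
    fun X hX => (Matrix.isNilpotent_trace_of_isNilpotent (hX.pow_succ 3)).eq_zero
  have hA : IsNilpotent A := by simpa using h 1 0
  have hB : IsNilpotent B := by simpa using h 0 1
  have hP : IsNilpotent (A + B) := by simpa using h 1 1
  have hM : IsNilpotent (A - B) := by
    have h' := h 1 (-1)
    simp only [one_smul, neg_smul] at h'
    rwa [← sub_eq_add_neg] at h'
  have e1 : (A + B) ^ 4 + (A - B) ^ 4 =
      ((A * A + B * B) * (A * A + B * B) + (A * B + B * A) * (A * B + B * A)) +
      ((A * A + B * B) * (A * A + B * B) + (A * B + B * A) * (A * B + B * A)) := by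
    noncomm_ring
  have e2 := congrArg Matrix.trace e1
  rw [Matrix.trace_add, tr4 _ hP, tr4 _ hM] at e2
  simp only [add_mul, mul_add, Matrix.trace_add] at e2
  have w1 : Matrix.trace (A * A * (A * A)) = 0 := by
    rw [show A * A * (A * A) = A ^ 4 by noncomm_ring]; exact tr4 _ hA
  have w4 : Matrix.trace (B * B * (B * B)) = 0 := by
    rw [show B * B * (B * B) = B ^ 4 by noncomm_ring]; exact tr4 _ hB
  have w3 : Matrix.trace (B * B * (A * A)) = Matrix.trace (A * A * (B * B)) := Matrix.trace_mul_comm _ _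
  have w6 : Matrix.trace (A * B * (B * A)) = Matrix.trace (A * A * (B * B)) := by
    rw [show A * B * (B * A) = A * (B * B * A) by noncomm_ring, Matrix.trace_mul_comm,
      show B * B * A * A = B * B * (A * A) by noncomm_ring, Matrix.trace_mul_comm]
  have w7 : Matrix.trace (B * A * (A * B)) = Matrix.trace (A * A * (B * B)) := by
    rw [show B * A * (A * B) = B * (A * A * B) by noncomm_ring, Matrix.trace_mul_comm,
      show A * A * B * B = A * A * (B * B) by noncomm_ring]
  have w8 : Matrix.trace (B * A * (B * A)) = Matrix.trace (A * B * (A * B)) := by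
    rw [show B * A * (B * A) = B * (A * B * A) by noncomm_ring, Matrix.trace_mul_comm,
      show A * B * A * B = A * B * (A * B) by noncomm_ring]
  rw [w1, w4, w3, w6, w7, w8] at e2
  rw [pow_two, show A ^ 2 * B ^ 2 = A * A * (B * B) by noncomm_ring]
  linear_combination (-1/4 : ℂ) * e2

/-- The three-level test space of Mathes–Omladič–Radjavi type with a general
lowering block `S`: `M S T = [[0,S,0],[T,0,-S],[0,T,0]]` on `Fin 3 × Fin k`. -/
def threeLevel {k : ℕ} (S T : Matrix (Fin k) (Fin k) ℂ) :
    Matrix (Fin 3 × Fin k) (Fin 3 × Fin k) ℂ :=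
  Matrix.of fun p q =>
    if p.1 = 0 ∧ q.1 = 1 then S p.2 q.2
    else if p.1 = 1 ∧ q.1 = 0 then T p.2 q.2
    else if p.1 = 1 ∧ q.1 = 2 then -S p.2 q.2
    else if p.1 = 2 ∧ q.1 = 1 then T p.2 q.2
    else 0

/-- TOY RIGIDITY (fat side forces thin side).  If the raising side is the full
diagonal copy `{(T,T) : T ∈ M_k}` then nilpotency of the space forces the
lowering generator to be SCALAR: from `tr (M S T)^4 = 4(tr((ST)²) - tr(S²T²)) = 0`
for all `T` one gets `S = c•1` (hand proof in the card).  So MOR's `𝓜_k` is the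
only member of its family: its thin side has dimension exactly one. -/
theorem scalar_of_fullBlock {k : ℕ} (S : Matrix (Fin k) (Fin k) ℂ)
    (h : ∀ T : Matrix (Fin k) (Fin k) ℂ, IsNilpotent (threeLevel S T)) :
    ∃ c : ℂ, S = c • (1 : Matrix (Fin k) (Fin k) ℂ) := by
  sorry

/-- Positive part of a matrix for an integer weight vector `w` (entries going UP in weight). -/
def posPart {d : ℕ} (w : Fin d → ℤ) (A : Matrix (Fin d) (Fin d) ℂ) : Matrix (Fin d) (Fin d) ℂ :=
  Matrix.of fun i j => if w j < w i then A i j else 0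

/-- Negative part (entries going DOWN in weight). -/
def negPart {d : ℕ} (w : Fin d → ℤ) (A : Matrix (Fin d) (Fin d) ℂ) : Matrix (Fin d) (Fin d) ℂ :=
  Matrix.of fun i j => if w i < w j then A i j else 0

/-- `U` is graded by the one-parameter subgroup `t ↦ diag(t^{w i})`: it contains the
positive and negative parts of each of its elements. -/
def IsGradedBy {d : ℕ} (w : Fin d → ℤ) (U : Submodule ℂ (Matrix (Fin d) (Fin d) ℂ)) : Prop :=
  ∀ A ∈ U, posPart w A ∈ U ∧ negPart w A ∈ U

/-- CONJECTURE (PB) «graded thin side»: a torus-graded IRREDUCIBLE linear space of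
nilpotent matrices has one thin side — `min(dim U₊, dim U₋) ≤ C·d`.  (Every
irreducible space of the census — `Irr₃`, `𝓜_k`, `L_k`, `L′_k`, `W(m)`, `Irr(6,7)` —
is graded with thin side of dimension 1.)  With the grading's own flag as
certificate this gives `HalfSpeedIrrLaw` / weight-thinness for the graded class
(`Θ·codim = L·(thin side) ≤ d·C·d`). -/
def GradedThinSide : Prop :=
  ∃ C : ℕ, ∀ (d : ℕ) (w : Fin d → ℤ) (U : Submodule ℂ (Matrix (Fin d) (Fin d) ℂ)),
    (∀ A ∈ U, IsNilpotent A) →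
    (∀ V : Submodule ℂ (Fin d → ℂ), (∀ A ∈ U, ∀ x ∈ V, A *ᵥ x ∈ V) → V = ⊥ ∨ V = ⊤) →
    IsGradedBy w U →
    min (Module.finrank ℂ ↥(Submodule.span ℂ (posPart w '' (U : Set (Matrix (Fin d) (Fin d) ℂ)))))
        (Module.finrank ℂ ↥(Submodule.span ℂ (negPart w '' (U : Set (Matrix (Fin d) (Fin d) ℂ)))))
      ≤ C * d

/-- GRADED RUNG of β's law: (PB) ⇒ half-speed for graded irreducible spaces with the
grading flag (`T` = fat side climbs ≥ 1 weight, the thin side drops; words with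
`#Q > L + #P` leave the weight range).  Stated here only as the target shape. -/
theorem halfSpeed_of_graded_placeholder : GradedThinSide → True := fun _ => trivial

end Summit.ValiantsHypothesis.ValiantsHypothesis.Cruxes.DualUnipotentThreeHalves.GradedThinSide
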